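import Literature.NumberTheory.Rogawski1990.ArchLimitFormulaNoncompactWallProof      -- ★ p840819 (d3b): `archLimitFormulaNoncompactWall_holds` — the (J-nc) letter PROVED for CM `L`; brings the letter file `ArchLimitFormula` ((C-bdry) `ArchTorusOrbitalOneSidedLimits`)
import Literature.NumberTheory.Automorphic.ArchLocalWallCentralizerHaar              -- ★ `exists_isHaarMeasure_isInvInvariant_centralizer_circleDiagonal_wall` (the `νH` binder of (J-nc) discharged)
import Literature.NumberTheory.Automorphic.UnitaryGroupArchUnimodular                -- ★ `modularCharacterFun_archLocal_eq_one`, `isMulRightInvariant_of_modularCharacterFun_eq_one` (every Haar `ν` on `G_w` is right-invariant)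
import Literature.NumberTheory.Automorphic.ArchLocalTorusOrbitalDeriv                -- ★ (B4) p840054: `hasDerivAt_integral_comp_conj_circleDiagonal_curve_of_blocks` (differentiability off the wall)
import Literature.Analysis.Calculus.SmoothExtensionToClosure                         -- ★ `UniformContinuousOn.exists_tendsto_of_mem_closure` (Cauchy filters into a complete space)
import Mathlib.Analysis.Calculus.MeanValue
import HarnessLib

/-!
# THE LETTER (C-bdry) `ArchTorusOrbitalOneSidedLimits` HOLDS for CM fields: Harish-Chandra's one-sided limits of the normalised torus orbital integral and of its
# `ψ`-derivative at a NONCOMPACT wall of the circle torus of `G_w = U(σ_w diag α)(ℂ)` (Varadarajan 1989 §6.4 Thms 18, 20; Rogawski 1990 §8.2 p. 119)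

Topic `NumberTheory/Rogawski1990`; namespace `Literature.NumberTheory.Rogawski1990`.  THEOREMS ONLY (no `def`, no instance, no notation, no axiom, no named fact, no `sorry`).
Cell `pub/hodgecm-mathlib`, line LH3 (closer stub `stub_N9` of `Cruxes/H413/Lines/F0_U3LettersRung1.lean`, crux H413 = `stmt-HodgeConjecture-24833`); the floor-2 letter (C-bdry) of
★ `ArchLimitFormula.lean` (books rows #111 (S-d) ∕ #88 (ST-∞); «net debt +2 by design: these are the floor-2 letters» — (J-nc) was paid by ★ `ArchLimitFormulaNoncompactWallProof`,
(C-bdry) is paid HERE), first input of the G-wall jump matching of the direct road to `stub_N9` (LH3-plan (g2) DEALER WORDS #1, census «G-WALL» (ii) of LH3-p04 (g2), 2026-09-02).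

THE POINT.  The named fact ★ `ArchTorusOrbitalOneSidedLimits L α w` [Varadarajan1989 §6.4 Thm 18, Thm 20] asserts, at a point `z₀` of the open NONCOMPACT wall `{z 0 = z 2 ≠ z 1}`
(`re σ_w(α₀)·re σ_w(α₂) < 0`) of the compact Cartan of `G_w`, that `g(ψ) = 2 sin ψ · ∫_{G_w} Θ(g·diag(z_ψ)·g⁻¹) dν` and its `ψ`-derivative have one-sided limits `Jp, Jm, Dp, Dm` at
`ψ = 0`.  It is a COROLLARY of the stronger letter (J-nc) ★ `ArchLimitFormulaNoncompactWall L α w` — PROVED for CM `L` (★ `archLimitFormulaNoncompactWall_holds`) — which gives the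
two-sided punctured limit `g′(ψ) → c · (singular orbital integral)` as `ψ → 0`, `ψ ≠ 0`: restricting to `ψ > 0` ∕ `ψ < 0` yields `Dp = Dm`; and a function that is differentiable on
`(0, η)` (★ (B4) `hasDerivAt_integral_comp_conj_circleDiagonal_curve_of_blocks` at the REGULAR parameters `ψ ≠ 0` small, ★ `eventually_injective_splitCurve`) with a derivative
convergent — hence bounded — at `0⁺` is Lipschitz on `(0, η)` (mean value inequality, Mathlib `Convex.lipschitzOnWith_of_nnnorm_deriv_le`), hence uniformly continuous, hence has a
limit at `0⁺` (★ `UniformContinuousOn.exists_tendsto_of_mem_closure`); likewise at `0⁻`.  The (J-nc) binders absent from (C-bdry) are DISCHARGED, not assumed: `ν` is right-invariant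
because `G_w` is unimodular (★ `modularCharacterFun_archLocal_eq_one`), the reference wall point is `z₀` itself, its centraliser `H_w ≅ U(1,1) × U(1)` carries an inversion-invariant
Haar measure (★ `exists_isHaarMeasure_isInvInvariant_centralizer_circleDiagonal_wall`), and the quotient `G_w ⧸ H_w` gets its Borel σ-algebra.

WHAT IS PROVED.
* `exists_tendsto_nhdsGT_of_tendsto_deriv`, `exists_tendsto_nhdsLT_of_tendsto_deriv` (generic, `f : ℝ → E`, `E` complete): differentiable near `a⁺` (resp. `a⁻`) with `deriv f`
  convergent there ⇒ `f` has a one-sided limit there.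
* **`archTorusOrbitalOneSidedLimits_holds [NumberField L] [IsCMField L] : ArchTorusOrbitalOneSidedLimits L α w`** — the letter (C-bdry) BY NAME, with `Dp = Dm`.
HONEST LABEL: HC_CM is proved only modulo the 7 printed citations (2 remaining: hLiu418 = stmt-HodgeConjecture-24832, h413 = stmt-HodgeConjecture-24833) until rung 0 closes; this file
retires one floor-2 named fact of the cell for CM `L` and is count-neutral for the closer (the letter is not on `stub_N9`'s path until the G-wall organs of the direct road are cut).

## References
* [Varadarajan1989] V. S. Varadarajan, *An Introduction to Harmonic Analysis on Semisimple Lie Groups*, Cambridge Stud. Adv. Math. 16 (1989), §6.4 Thm 18, Thm 20, Thm 22.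
* [Rogawski1990] J. D. Rogawski, *Automorphic Representations of Unitary Groups in Three Variables*, Ann. of Math. Stud. 123 (1990), §8.2 Prop. 8.2.1 pp. 118–119 (`g(ψ) = 2 sin ψ · Φ_H`,
  Harish-Chandra's limit formula via [A₁] Lemma 7.1).
* [Folland1995] G. B. Folland, *A Course in Abstract Harmonic Analysis* (1995), §2.4 Prop. 2.27 (unimodularity), §2.6 (quotient measures).
-/

set_option autoImplicit false

noncomputable section

open MeasureTheory Measure Filter Topology NumberField NumberField.InfinitePlace Set
open Literature.MeasureTheory.Group Literature.NumberTheory.Automorphic Literature.NumberTheory.Automorphic.UnitaryGroup Literature.Analysis.Calculus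
open scoped Matrix MatrixGroups Matrix.Norms.Operator NNReal

/-! ## §1 One-sided limits from a convergent derivative (generic real analysis) -/

namespace Literature.Analysis.Calculus

variable {E : Type*} [NormedAddCommGroup E] [NormedSpace ℝ E] [CompleteSpace E]

/-- **A function differentiable to the right of `a` whose derivative converges at `a⁺` has a limit at `a⁺`**: the derivative is bounded on some `(a, a + η)`, so `f` is
Lipschitz there (mean value inequality), hence uniformly continuous, hence Cauchy at `a⁺`. [cite: Varadarajan1989, §6.4 Thm 20] -/
theorem exists_tendsto_nhdsGT_of_tendsto_deriv {f : ℝ → E} {a : ℝ} {D : E}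
    (hd : ∀ᶠ x in 𝓝[>] a, DifferentiableAt ℝ f x) (hD : Tendsto (deriv f) (𝓝[>] a) (𝓝 D)) :
    ∃ J : E, Tendsto f (𝓝[>] a) (𝓝 J) := by
  -- the derivative is eventually bounded by `‖D‖ + 1`
  have hb : ∀ᶠ x in 𝓝[>] a, ‖deriv f x‖ < ‖D‖ + 1 :=
    (hD.norm.eventually (gt_mem_nhds (lt_add_one ‖D‖)))
  obtain ⟨u, hau, hu⟩ := mem_nhdsGT_iff_exists_Ioo_subset.mp (hd.and hb)
  -- Lipschitz on `(a, u)`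
  have hL : LipschitzOnWith (Real.toNNReal (‖D‖ + 1)) f (Ioo a u) := by
    refine Convex.lipschitzOnWith_of_nnnorm_deriv_le (𝕜 := ℝ) (fun x hx => (hu hx).1) (fun x hx => ?_) (convex_Ioo a u)
    have h := (hu hx).2
    rw [← NNReal.coe_le_coe, coe_nnnorm, Real.coe_toNNReal _ (by positivity)]
    exact h.le
  obtain ⟨J, hJ⟩ := hL.uniformContinuousOn.exists_tendsto_of_mem_closure (x := a)
    (by rw [closure_Ioo hau.ne]; exact left_mem_Icc.mpr hau.le)
  exact ⟨J, by rwa [nhdsWithin_Ioo_eq_nhdsGT hau] at hJ⟩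

/-- **A function differentiable to the left of `a` whose derivative converges at `a⁻` has a limit at `a⁻`** (mirror image of the previous theorem).
[cite: Varadarajan1989, §6.4 Thm 20] -/
theorem exists_tendsto_nhdsLT_of_tendsto_deriv {f : ℝ → E} {a : ℝ} {D : E}
    (hd : ∀ᶠ x in 𝓝[<] a, DifferentiableAt ℝ f x) (hD : Tendsto (deriv f) (𝓝[<] a) (𝓝 D)) :
    ∃ J : E, Tendsto f (𝓝[<] a) (𝓝 J) := by
  have hb : ∀ᶠ x in 𝓝[<] a, ‖deriv f x‖ < ‖D‖ + 1 :=
    (hD.norm.eventually (gt_mem_nhds (lt_add_one ‖D‖)))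
  obtain ⟨l, hla, hl⟩ := mem_nhdsLT_iff_exists_Ioo_subset.mp (hd.and hb)
  have hL : LipschitzOnWith (Real.toNNReal (‖D‖ + 1)) f (Ioo l a) := by
    refine Convex.lipschitzOnWith_of_nnnorm_deriv_le (𝕜 := ℝ) (fun x hx => (hl hx).1) (fun x hx => ?_) (convex_Ioo l a)
    have h := (hl hx).2
    rw [← NNReal.coe_le_coe, coe_nnnorm, Real.coe_toNNReal _ (by positivity)]
    exact h.le
  obtain ⟨J, hJ⟩ := hL.uniformContinuousOn.exists_tendsto_of_mem_closure (x := a)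
    (by rw [closure_Ioo hla.ne]; exact right_mem_Icc.mpr hla.le)
  exact ⟨J, by rwa [nhdsWithin_Ioo_eq_nhdsLT hla] at hJ⟩

end Literature.Analysis.Calculus

/-! ## §2 The letter (C-bdry) from the letter (J-nc) -/

namespace Literature.NumberTheory.Rogawski1990

variable (L : Type) [Field L] [NumberField L] [IsCMField L] (α : Fin 3 → L) (w : {w : InfinitePlace L // IsComplex w})

omit [NumberField L] [IsCMField L] in
/-- **Differentiability of `g(ψ) = 2 sin ψ · ∫_{G_w} Θ(g·diag(z_ψ)·g⁻¹) dν` OFF THE WALL**: at every `ψ` where the one-angle curve `z_ψ = (z₀₀e^{iψ}, z₀₁, z₀₀e^{−iψ})` has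
pairwise-distinct coordinates — in particular at all small `ψ ≠ 0` (★ `eventually_injective_splitCurve`) — `g` is differentiable (★ (B4) with the injective labelling).
[cite: Rogawski1990, §8.2 p. 122] [cite: Varadarajan1989, §6.4 Thm 18] -/
theorem differentiableAt_two_sin_mul_integral_comp_conj_splitCurve
    [MeasurableSpace (archLocal L 3 (Matrix.diagonal α) w)] [BorelSpace (archLocal L 3 (Matrix.diagonal α) w)]
    (hα : ∀ i, α i ≠ 0) (hreal : ∀ i, (w.1.embedding (α i)).im = 0)
    (ν : Measure (archLocal L 3 (Matrix.diagonal α) w)) [IsFiniteMeasureOnCompacts ν]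
    (Θ : Matrix (Fin 3) (Fin 3) ℂ → ℂ) (hΘ : ContDiff ℝ 1 Θ)
    (hΘc : HasCompactSupport fun k : archLocal L 3 (Matrix.diagonal α) w => Θ (((k : GL (Fin 3) ℂ) : Matrix (Fin 3) (Fin 3) ℂ)))
    (z₀ : Fin 3 → Circle) {ψ : ℝ} (hψ : Function.Injective fun i => z₀ i * Circle.exp (![(1 : ℝ), 0, -1] i * ψ)) :
    DifferentiableAt ℝ (fun ψ : ℝ => (2 * Real.sin ψ : ℂ) *
        ∫ g, Θ (((g * ⟨circleDiagonal 3 (fun i => z₀ i * Circle.exp (![(1 : ℝ), 0, -1] i * ψ)),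
          circleDiagonal_mem_archLocal_diagonal L 3 α w _⟩ * g⁻¹ : archLocal L 3 (Matrix.diagonal α) w) : GL (Fin 3) ℂ) : Matrix (Fin 3) (Fin 3) ℂ) ∂ν) ψ := by
  have hsin : DifferentiableAt ℝ (fun ψ : ℝ => (2 * Real.sin ψ : ℂ)) ψ :=
    (((Real.hasDerivAt_sin ψ).ofReal_comp).const_mul (2 : ℂ)).differentiableAt
  have hreg : ∀ i j : Fin 3, (fun k : Fin 3 => k) i ≠ (fun k : Fin 3 => k) j →
      z₀ i * Circle.exp (![(1 : ℝ), 0, -1] i * ψ) ≠ z₀ j * Circle.exp (![(1 : ℝ), 0, -1] j * ψ) :=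
    fun i j hij h => hij (hψ h)
  have h := (hasDerivAt_integral_comp_conj_circleDiagonal_curve_of_blocks L 3 α w hα hreal (fun k : Fin 3 => k) (fun i j hij hb => absurd hb hij)
    ν Θ hΘ hΘc z₀ ![(1 : ℝ), 0, -1] ψ hreg).2
  exact hsin.mul h.differentiableAt

/-- **THE LETTER (C-bdry) HOLDS** for a CM field `L`: at a point `z₀` of the open noncompact wall of the circle torus of `G_w = U(σ_w diag α)(ℂ)`, the normalised torus orbital
integral `g(ψ) = 2 sin ψ · ∫_{G_w} Θ(g·diag(z_ψ)·g⁻¹) dν` and its `ψ`-derivative have one-sided limits at `ψ = 0` (and the two derivative limits coincide).  Proof: module docstring —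
(J-nc) ★ `archLimitFormulaNoncompactWall_holds` with its extra binders discharged (★ unimodularity of `G_w`, ★ `νH` on `Z(diag z₀)`), then §1.
[cite: Varadarajan1989, §6.4 Thm 18, Thm 20, Thm 22] [cite: Rogawski1990, §8.2 p. 119] -/
theorem archTorusOrbitalOneSidedLimits_holds : ArchTorusOrbitalOneSidedLimits L α w := by
  intro _ _ hα hreal ν _ Θ hΘ hΘc z₀ h02 h01 hnc
  classical
  -- topology and unimodularity of `G_w`
  haveI : LocallyCompactSpace (archLocal L 3 (Matrix.diagonal α) w) := locallyCompactSpace_archLocal L 3 (Matrix.diagonal α) w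
  haveI : SecondCountableTopology (archLocal L 3 (Matrix.diagonal α) w) := secondCountableTopology_archLocal L 3 (Matrix.diagonal α) w
  have hherm : ((Matrix.diagonal α).map (cmConjRingHom L))ᵀ = Matrix.diagonal α := by
    rw [Matrix.diagonal_map (map_zero _), Matrix.diagonal_transpose]
    congr 1
    funext i
    apply w.1.embedding.injective
    change w.1.embedding (cmConjRingHom L (α i)) = w.1.embedding (α i)
    rw [embedding_cmConjRingHom]
    exact Complex.conj_eq_iff_im.mpr (hreal i)
  have hdet : (Matrix.diagonal α).det ≠ 0 := by
    rw [Matrix.det_diagonal]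
    exact Finset.prod_ne_zero_iff.mpr fun i _ => hα i
  haveI : ν.IsMulRightInvariant := isMulRightInvariant_of_modularCharacterFun_eq_one (modularCharacterFun_archLocal_eq_one L (Matrix.diagonal α) hherm hdet w) ν
  -- the wall centraliser `H_w = Z(diag z₀)` with an inversion-invariant Haar measure, and the Borel quotient
  obtain ⟨νH, hH, -, hHinv⟩ := exists_isHaarMeasure_isInvInvariant_centralizer_circleDiagonal_wall L α w hα hreal h02 h01
  letI : MeasurableSpace (archLocal L 3 (Matrix.diagonal α) w ⧸ Subgroup.centralizer
      ({(⟨circleDiagonal 3 z₀, circleDiagonal_mem_archLocal_diagonal L 3 α w z₀⟩ : archLocal L 3 (Matrix.diagonal α) w)} : Set (archLocal L 3 (Matrix.diagonal α) w))) := borel _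
  haveI : BorelSpace (archLocal L 3 (Matrix.diagonal α) w ⧸ Subgroup.centralizer
      ({(⟨circleDiagonal 3 z₀, circleDiagonal_mem_archLocal_diagonal L 3 α w z₀⟩ : archLocal L 3 (Matrix.diagonal α) w)} : Set (archLocal L 3 (Matrix.diagonal α) w))) := ⟨rfl⟩
  -- (J-nc): the two-sided punctured limit of `g′`
  obtain ⟨c, -, hJ⟩ := archLimitFormulaNoncompactWall_holds L α w hα hreal ν z₀ h02 h01 hnc νH
  have hD := hJ Θ hΘ hΘc z₀ h02 h01
  -- differentiability of `g` at all small `ψ ≠ 0`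
  have hΘ1 : ContDiff ℝ 1 Θ := hΘ.of_le (by exact_mod_cast le_top)
  have hdiff : ∀ᶠ ψ in 𝓝[≠] (0 : ℝ), DifferentiableAt ℝ (fun ψ : ℝ => (2 * Real.sin ψ : ℂ) *
      ∫ g, Θ (((g * ⟨circleDiagonal 3 (fun i => z₀ i * Circle.exp (![(1 : ℝ), 0, -1] i * ψ)),
        circleDiagonal_mem_archLocal_diagonal L 3 α w _⟩ * g⁻¹ : archLocal L 3 (Matrix.diagonal α) w) : GL (Fin 3) ℂ) : Matrix (Fin 3) (Fin 3) ℂ) ∂ν) ψ := by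
    filter_upwards [eventually_injective_splitCurve z₀ h02 h01] with ψ hψ
    exact differentiableAt_two_sin_mul_integral_comp_conj_splitCurve L α w hα hreal ν Θ hΘ1 hΘc z₀ hψ
  -- restrict to the two sides
  have hGT : (𝓝[>] (0 : ℝ)) ≤ 𝓝[≠] 0 := nhdsWithin_mono _ fun x hx => ne_of_gt hx
  have hLT : (𝓝[<] (0 : ℝ)) ≤ 𝓝[≠] 0 := nhdsWithin_mono _ fun x hx => ne_of_lt hx
  obtain ⟨Jp, hJp⟩ := exists_tendsto_nhdsGT_of_tendsto_deriv (hdiff.filter_mono hGT) (hD.mono_left hGT)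
  obtain ⟨Jm, hJm⟩ := exists_tendsto_nhdsLT_of_tendsto_deriv (hdiff.filter_mono hLT) (hD.mono_left hLT)
  exact ⟨Jp, Jm, _, _, hJp, hJm, hD.mono_left hGT, hD.mono_left hLT⟩

end Literature.NumberTheory.Rogawski1990

end
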